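import Summits.CriticalPhenomena.CardyFormulaZ2.Theses.CardySectorGap
import Literature.Probability.Percolation.SiteEmbDomainCrossing
import Literature.Probability.Percolation.SitePercolationMeasure
import Literature.Probability.Percolation.SiteConnectionTools
import HarnessLib

/-!
# `DomainShiftBalance` ⟺ one-mesh translation continuity of the type-II pivotal mass (stub `stub_domainShiftBalance`)

Helper file for the crux `CardyFlipRusso.CoveringLeg` (stmt-CriticalPhenomena-6435), line
`five-arm-null`, registered stub `stub_domainShiftBalance` (= route CardySectorGap's item
`DomainShiftBalance`, stmt-CriticalPhenomena-7053).  Self-contained against that item's `let`s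
(`Gs`, `z`, `P q = prodBernoulli (mixedParam q)`, `cross`, `piv`); no new definitions.

Beffara 2008, §5.2: translating a configuration of the mixed percolation `P_{1/2,q}` on the centred
square lattice `G_s` by an ODD lattice vector `t` (`t.1 + t.2` odd; Beffara's shift is `(1, 0)`)
gives a configuration of law `P_{1/2,1-q}` (tree: `mixedPi_map_mixedTranslate_of_odd`) and exchanges
the two classes of face centres (type II = even centres, type III = odd).  The translation is an
automorphism of `G_s` (`shift_gs_adj_mixedTranslate`) acting on the covering-adapted embedding `z`
of route CardySectorGap by the complex translation `w_t = ((t.1 + t.2) + (t.2 - t.1) i)/√2`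
(`shift_z_mixedTranslate`).  Hence the crude crossing event of `(Ω; A, B)` at mesh `δ` pulls back,
under relabelling by the translation, to that of the translated data `(Ω - δw_t; A - δw_t, B - δw_t)`
(`shift_relabel_preimage_siteEmbDomainCrossing`), pivotality of `inr (f + t)` to pivotality of
`inr f` (`shift_relabel_preimage_pivotal`), and the law transports
(`shift_prodBernoulli_map_relabel_of_odd`).  Upshot, the EXACT IDENTITY
`shift_massIII_eq_massII_translate`: the type-III pivotal mass of `(Ω; A, B)` under `P_q` equals the
type-II pivotal mass of the translated data under `P_{1-q}` (reindex `f ↦ f + t` by `Equiv.tsum_eq`,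
no summability needed).  Consequently stmt-7053 is EQUIVALENT
(`shift_domainShiftBalance_iff_translationContinuity`) to: the type-II pivotal mass of the crude
crossing of `R` changes by `o(1)` as `δ → 0⁺`, uniformly in `q ∈ [0, 1]`, when `Ω_R` and its two
marked arcs are translated by ONE mesh step `δ w_t` relative to the lattice — Beffara's
eq. (almost) ("Russo–Seymour–Welsh estimates are actually enough to obtain a formal proof of this
estimate", §5.2), a boundary three-arm counting estimate for the mixed family which needs RSW for
`P_{1/2,q}` on `G_s` uniform in `q` (Köhler-Schindler–Tassion 2023, Thm 1, in print) and is NOT in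
the tree; `shift_domainShiftBalance_of_translationContinuity` is the reduction of the stub to it.

## References

* V. Beffara, *Is critical 2D percolation universal?*, In and Out of Equilibrium 2, Progr. Probab.
  60 (2008), §5.1–§5.2, eq. (almost). [Beffara2008Universal]
* G. Grimmett, I. Manolescu, *Bond percolation on isoradial graphs*, PTRF 159 (2014), §2.2
  (embedded crossing events). [GrimmettManolescu2014]
-/

noncomputable section

namespace Summit.CriticalPhenomena.CardyFormulaZ2.Cruxes.CoveringLeg.FiveArmNull

open scoped Classical
open Set MeasureTheory
open Literature.Probability.RandomPlanarGeometry Literature.Probability.Percolation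
open Literature.Probability.LatticeModels
open Literature.Barriers.CriticalPhenomena
open Summit.CriticalPhenomena.CardyFormulaZ2.Theses

/-! ### Translating `infDist`; relabelling a pivotal event; transporting the crude crossing event -/

/-- Translation invariance of the distance to a set, in preimage form:
`infDist (x + d) A = infDist x (A - d)` with `A - d` the preimage `(· + d) ⁻¹' A`. [folklore] -/
theorem shift_infDist_add_right (x d : ℂ) (A : Set ℂ) :
    Metric.infDist (x + d) A = Metric.infDist x ((fun y : ℂ => y + d) ⁻¹' A) := by
  have h := Metric.infDist_image (isometry_add_right d) (x := x) (t := (fun y : ℂ => y + d) ⁻¹' A)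
  rwa [Set.image_preimage_eq _ (add_right_surjective d)] at h

/-- Relabelling sites along a bijection `e` carries the event "`e v` is pivotal for `S`"
(Beffara's Definition 17: `S` holds with the site opened and fails with it closed) to the event
"`v` is pivotal for the pulled-back event". [cite: Beffara2008Universal, §5.2 Def. 17] -/
theorem shift_relabel_preimage_pivotal {V : Type*} (e : V ≃ V) (S : Set (Set V)) (v : V) :
    SiteConfig.relabel e ⁻¹' {ω | insert (e v) ω ∈ S ∧ ω \ {e v} ∉ S} =
      {ω | insert v ω ∈ SiteConfig.relabel e ⁻¹' S ∧ ω \ {v} ∉ SiteConfig.relabel e ⁻¹' S} := by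
  ext ω
  simp only [Set.mem_preimage, Set.mem_setOf_eq, SiteConfig.relabel_apply, Set.image_insert_eq,
    Set.image_sdiff e.injective, Set.image_singleton]

/-- **Event transport.** Let `e` be a bijection of the vertices preserving adjacency of `G`, acting
on the embedding `z` by the complex translation `w` (`z (e y) = z y + w`).  Then the pull-back under
relabelling by `e` of the crude crossing event of `(Ω; A, B)` at mesh `δ` is the crude crossing
event of the translated data `(Ω - δw; A - δw, B - δw)` (preimages under `x ↦ x + δ w`) at the same
mesh: windows, `2δ`-collars of the arcs and open paths are all carried along.
[cite: GrimmettManolescu2014, §2.2] -/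
theorem shift_relabel_preimage_siteEmbDomainCrossing {V : Type*} {G : SimpleGraph V} {e : V ≃ V}
    (hG : ∀ a b, G.Adj (e a) (e b) ↔ G.Adj a b) {z : V → ℂ} {w : ℂ} (hz : ∀ y, z (e y) = z y + w)
    (Ω : Set ℂ) (δ : ℝ) (A B : Set ℂ) :
    SiteConfig.relabel e ⁻¹' siteEmbDomainCrossing G z Ω δ A B =
      siteEmbDomainCrossing G z ((fun x : ℂ => x + (δ : ℂ) * w) ⁻¹' Ω) δ
        ((fun x : ℂ => x + (δ : ℂ) * w) ⁻¹' A) ((fun x : ℂ => x + (δ : ℂ) * w) ⁻¹' B) := by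
  let φ : G ≃g G := ⟨e, fun {a b} => hG a b⟩
  have hpos : ∀ y, (δ : ℂ) * z (e y) = (δ : ℂ) * z y + (δ : ℂ) * w := fun y => by
    rw [hz, mul_add]
  have hW : {y | (δ : ℂ) * z y ∈ Ω} =
      e '' {y | (δ : ℂ) * z y ∈ (fun x : ℂ => x + (δ : ℂ) * w) ⁻¹' Ω} := by
    rw [Equiv.image_eq_preimage_symm]
    ext y
    simp only [Set.mem_setOf_eq, Set.mem_preimage]
    rw [← hpos (e.symm y), Equiv.apply_symm_apply]
  ext ω
  simp only [Set.mem_preimage, mem_siteEmbDomainCrossing_iff]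
  constructor
  · rintro ⟨u, v, hu, hv, h⟩
    refine ⟨e.symm u, e.symm v, ?_, ?_, ?_⟩
    · rw [← shift_infDist_add_right, ← hpos, Equiv.apply_symm_apply]; exact hu
    · rw [← shift_infDist_add_right, ← hpos, Equiv.apply_symm_apply]; exact hv
    · rw [hW, ← e.apply_symm_apply u, ← e.apply_symm_apply v] at h
      exact (relabel_mem_siteConnIn_iff φ ω _ (e.symm u) (e.symm v)).1 h
  · rintro ⟨u, v, hu, hv, h⟩
    refine ⟨e u, e v, ?_, ?_, ?_⟩
    · rw [hpos, shift_infDist_add_right]; exact hu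
    · rw [hpos, shift_infDist_add_right]; exact hv
    · rw [hW]
      exact (relabel_mem_siteConnIn_iff φ ω _ u v).2 h

/-! ### Transport of Beffara's law `P_q = prodBernoulli (mixedParam q)` along an odd translation -/

/-- **Beffara 2008, §5.2, in relabelling form.** For `t.1 + t.2` odd, the image of
`P_{1/2,q} = prodBernoulli (mixedParam q)` under relabelling the open set along the translation by
`t` (`ω ↦ t + ω`) is `P_{1/2,1-q}` (the tree's `mixedPi_map_mixedTranslate_of_odd` on the
`MixedSite → Prop` model, through the bridge `prodBernoulli_mixedParam`). [cite: Beffara2008Universal, §5.2] -/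
theorem shift_prodBernoulli_map_relabel_of_odd (q : unitInterval) {t : ℤ × ℤ} (ht : Odd (t.1 + t.2)) :
    (prodBernoulli (mixedParam q)).map (SiteConfig.relabel (mixedTranslate t)) =
      prodBernoulli (mixedParam (unitInterval.symm q)) := by
  rw [prodBernoulli_mixedParam, prodBernoulli_mixedParam,
    Measure.map_map (SiteConfig.relabel (mixedTranslate t)).measurable measurable_setOf]
  have hcomm : ⇑(SiteConfig.relabel (mixedTranslate t)) ∘ (fun χ : MixedSite → Prop => {v | χ v}) =
      (fun χ : MixedSite → Prop => {v | χ v}) ∘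
        ⇑(MeasurableEquiv.piCongrLeft (fun _ : MixedSite => Prop) (mixedTranslate t)) := by
    funext χ
    ext v
    simp only [Function.comp_apply, SiteConfig.relabel_apply, Set.mem_image_equiv, Set.mem_setOf_eq,
      MeasurableEquiv.coe_piCongrLeft, Equiv.piCongrLeft_apply_eq_cast, cast_eq]
  rw [hcomm, ← Measure.map_map measurable_setOf (MeasurableEquiv.measurable _),
    mixedPi_map_mixedTranslate_of_odd q ht]

/-- Applied form: `P_q(S) = P_{1-q}({ω | t + ω ∈ S})` for every event `S` and odd `t` (no
measurability needed, relabelling being a measurable equivalence; `unitInterval.symm_symm`).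
[cite: Beffara2008Universal, §5.2] -/
theorem shift_prodBernoulli_real (q : unitInterval) {t : ℤ × ℤ} (ht : Odd (t.1 + t.2))
    (S : Set (Set MixedSite)) :
    (prodBernoulli (mixedParam q)).real S =
      (prodBernoulli (mixedParam (unitInterval.symm q))).real
        (SiteConfig.relabel (mixedTranslate t) ⁻¹' S) := by
  rw [measureReal_def, measureReal_def, ← MeasurableEquiv.map_apply,
    shift_prodBernoulli_map_relabel_of_odd (unitInterval.symm q) ht, unitInterval.symm_symm]

/-! ### The exact identity: type-III mass under `P_q` = type-II mass of the translated data under `P_{1-q}` -/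

/-- **Termwise identity.** For an odd translation `t` acting on the embedding by `w`
(`z (t + y) = z y + w`) and preserving the graph `G` on Beffara's vertex set: the `P_q`-probability
that the face centre `inr (f + t)` is pivotal for the crude crossing of `(Ω; A, B)` at mesh `δ`
equals the `P_{1-q}`-probability that `inr f` is pivotal for the crude crossing of the translated
data `(Ω - δw; A - δw, B - δw)`. [cite: Beffara2008Universal, §5.2] -/
theorem shift_real_pivotal_translate {G : SimpleGraph MixedSite} {z : MixedSite → ℂ} {t : ℤ × ℤ}
    {w : ℂ} (ht : Odd (t.1 + t.2))
    (hG : ∀ a b, G.Adj (mixedTranslate t a) (mixedTranslate t b) ↔ G.Adj a b)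
    (hz : ∀ y, z (mixedTranslate t y) = z y + w) (q : unitInterval) (Ω A B : Set ℂ) (δ : ℝ)
    (f : ℤ × ℤ) :
    (prodBernoulli (mixedParam q)).real
        {ω | insert (Sum.inr (f + t)) ω ∈ siteEmbDomainCrossing G z Ω δ A B ∧
          ω \ {Sum.inr (f + t)} ∉ siteEmbDomainCrossing G z Ω δ A B} =
      (prodBernoulli (mixedParam (unitInterval.symm q))).real
        {ω | insert (Sum.inr f) ω ∈ siteEmbDomainCrossing G z ((fun x : ℂ => x + (δ : ℂ) * w) ⁻¹' Ω) δ
              ((fun x : ℂ => x + (δ : ℂ) * w) ⁻¹' A) ((fun x : ℂ => x + (δ : ℂ) * w) ⁻¹' B) ∧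
          ω \ {Sum.inr f} ∉ siteEmbDomainCrossing G z ((fun x : ℂ => x + (δ : ℂ) * w) ⁻¹' Ω) δ
              ((fun x : ℂ => x + (δ : ℂ) * w) ⁻¹' A) ((fun x : ℂ => x + (δ : ℂ) * w) ⁻¹' B)} := by
  have hv : Sum.inr (f + t) = mixedTranslate t (Sum.inr f) := rfl
  rw [shift_prodBernoulli_real q ht, hv, shift_relabel_preimage_pivotal,
    shift_relabel_preimage_siteEmbDomainCrossing hG hz]

/-- **The exact identity (sums).** For an odd translation `t` of Beffara's vertex set acting on the
embedding `z` by `w` and preserving the graph `G`, the type-III pivotal mass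
`Σ_{f odd} P_q(inr f pivotal)` of the crude crossing of `(Ω; A, B)` at mesh `δ` equals the type-II
pivotal mass `Σ_{f even} P_{1-q}(inr f pivotal)` of the translated data `(Ω - δw; A - δw, B - δw)`:
reindex `f ↦ f + t` (`Equiv.tsum_eq`, no summability; `t` odd swaps the parities) and apply
`shift_real_pivotal_translate`.  For route CardySectorGap's `Gs`, `z` the two hypotheses are
`shift_gs_adj_mixedTranslate t` and `shift_z_mixedTranslate t` (`w = ((t.1 + t.2) + (t.2 - t.1) i)/√2`).
[cite: Beffara2008Universal, §5.2] -/
theorem shift_massIII_eq_massII_translate : ∀ {G : SimpleGraph Literature.Barriers.CriticalPhenomena.MixedSite} {z : Literature.Barriers.CriticalPhenomena.MixedSite → ℂ} {t : ℤ × ℤ} {w : ℂ}, Odd (t.1 + t.2) → (∀ a b, G.Adj (Literature.Barriers.CriticalPhenomena.mixedTranslate t a) (Literature.Barriers.CriticalPhenomena.mixedTranslate t b) ↔ G.Adj a b) → (∀ y, z (Literature.Barriers.CriticalPhenomena.mixedTranslate t y) = z y + w) → ∀ (q : unitInterval) (Ω A B : Set ℂ) (δ : ℝ), (∑' f : ℤ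 × ℤ, if Even (f.1 + f.2) then 0 else (Literature.Probability.LatticeModels.prodBernoulli (Literature.Barriers.CriticalPhenomena.mixedParam q)).real {ω | insert (Sum.inr f) ω ∈ Literature.Probability.Percolation.siteEmbDomainCrossing G z Ω δ A B ∧ ω \ {Sum.inr f} ∉ Literature.Probability.Percolation.siteEmbDomainCrossing G z Ω δ A B}) = ∑' f : ℤ × ℤ, if Even (f.1 + f.2) then (Literature.Probability.LatticeModels.prodBernoulli (Literature.Barriers.CriticalPhenomena.mixedParam (unitInterval.symm q))).real {ω | insert (Sum.inr f) ω ∈ Literature.Probability.Percolation.siteEmbDomainCrossing G z ((fun x : ℂ => x + (δ : ℂ) * w) ⁻¹' Ω) δ ((fun x : ℂ => x + (δ : ℂ) * w) ⁻¹' A) ((fun x : ℂ => x + (δ : ℂ) * w) ⁻¹' B) ∧ ω \ {Sum.inr f} ∉ Literature.Probability.Percolation.siteEmbDomainCrossing G z ((fun x : ℂ => x + (δ : ℂ) * w) ⁻¹' Ω) δ ((fun x : ℂ => x + (δ : ℂ) * w) ⁻¹' A) ((fun x : ℂ => x + (δ : ℂ) * w) ⁻¹' B)} else 0 := by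
  intro G z t w ht hG hz q Ω A B δ
  refine ((Equiv.addRight t).tsum_eq _).symm.trans (tsum_congr fun f => ?_)
  have hpar : Even ((f + t).1 + (f + t).2) ↔ ¬ Even (f.1 + f.2) := by
    rw [Prod.fst_add, Prod.snd_add, show f.1 + t.1 + (f.2 + t.2) = (f.1 + f.2) + (t.1 + t.2) by ring,
      Int.even_add]
    exact iff_false_right (Int.not_even_iff_odd.2 ht)
  simp only [Equiv.coe_addRight]
  by_cases h : Even (f.1 + f.2)
  · rw [if_neg (fun h' => hpar.1 h' h), if_pos h]
    exact shift_real_pivotal_translate ht hG hz q Ω A B δ f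
  · rw [if_pos (hpar.2 h), if_neg h]

/-! ### The odd translation on route CardySectorGap's `Gs`, `z` -/

/-- The translation by `t ∈ ℤ²` acts on the covering-adapted embedding `z` of route CardySectorGap
(verbatim its `let z`) by the complex translation `w_t = ((t.1 + t.2) + (t.2 - t.1) i)/√2` (for
Beffara's shift `t = (1, 0)`: `w = (1 - i)/√2`). [cite: Beffara2008Universal, §5.1] -/
theorem shift_z_mixedTranslate (t : ℤ × ℤ) (y : MixedSite) :
    (fun u : MixedSite => Sum.elim (fun x : ℤ × ℤ => (((x.1 + x.2 : ℤ) : ℂ) + ((x.2 - x.1 + 1 : ℤ) : ℂ) * Complex.I) / (Real.sqrt 2 : ℂ)) (fun f : ℤ × ℤ => (((f.1 + f.2 + 1 : ℤ) : ℂ) + ((f.2 - f.1 + 1 : ℤ) : ℂ) * Complex.I) / (Real.sqrt 2 : ℂ)) u) (mixedTranslate t y) =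
      (fun u : MixedSite => Sum.elim (fun x : ℤ × ℤ => (((x.1 + x.2 : ℤ) : ℂ) + ((x.2 - x.1 + 1 : ℤ) : ℂ) * Complex.I) / (Real.sqrt 2 : ℂ)) (fun f : ℤ × ℤ => (((f.1 + f.2 + 1 : ℤ) : ℂ) + ((f.2 - f.1 + 1 : ℤ) : ℂ) * Complex.I) / (Real.sqrt 2 : ℂ)) u) y +
        (((t.1 + t.2 : ℤ) : ℂ) + ((t.2 - t.1 : ℤ) : ℂ) * Complex.I) / (Real.sqrt 2 : ℂ) := by
  rcases y with x | f
  · simp only [mixedTranslate_inl, Sum.elim_inl]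
    push_cast
    ring
  · simp only [mixedTranslate_inr, Sum.elim_inr]
    push_cast
    ring

/-- Lattice translations preserve the generating relation of route CardySectorGap's `Gs` (verbatim
its `let Gs`: unit-distance `ℤ²` edges and centre-to-corner edges). [cite: Beffara2008Universal, §5.1] -/
theorem shift_gsRel_mixedTranslate (t : ℤ × ℤ) (u v : MixedSite) :
    ((∃ x y : ℤ × ℤ, mixedTranslate t u = Sum.inl x ∧ mixedTranslate t v = Sum.inl y ∧
        (x.1 - y.1) ^ 2 + (x.2 - y.2) ^ 2 = 1) ∨
      (∃ x f : ℤ × ℤ, mixedTranslate t u = Sum.inl x ∧ mixedTranslate t v = Sum.inr f ∧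
        (x.1 = f.1 ∨ x.1 = f.1 + 1) ∧ (x.2 = f.2 ∨ x.2 = f.2 + 1))) ↔
    ((∃ x y : ℤ × ℤ, u = Sum.inl x ∧ v = Sum.inl y ∧ (x.1 - y.1) ^ 2 + (x.2 - y.2) ^ 2 = 1) ∨
      (∃ x f : ℤ × ℤ, u = Sum.inl x ∧ v = Sum.inr f ∧
        (x.1 = f.1 ∨ x.1 = f.1 + 1) ∧ (x.2 = f.2 ∨ x.2 = f.2 + 1))) := by
  rcases u with ⟨u1, u2⟩ | ⟨u1, u2⟩ <;> rcases v with ⟨v1, v2⟩ | ⟨v1, v2⟩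
  · simp only [mixedTranslate_inl, Sum.inl.injEq, reduceCtorEq, exists_and_left, exists_eq_left',
      false_and, and_false, exists_false, or_false, add_sub_add_right_eq_sub]
  · simp only [mixedTranslate_inl, mixedTranslate_inr, Sum.inl.injEq, Sum.inr.injEq, reduceCtorEq,
      exists_and_left, exists_eq_left', false_and, and_false, exists_false, false_or]
    omega
  · simp only [mixedTranslate_inl, mixedTranslate_inr, reduceCtorEq, false_and, exists_false,
      or_self]
  · simp only [mixedTranslate_inr, reduceCtorEq, false_and, exists_false, or_self]

/-- Hence lattice translations are automorphisms of `Gs`. [cite: Beffara2008Universal, §5.1] -/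
theorem shift_gs_adj_mixedTranslate (t : ℤ × ℤ) (a b : MixedSite) :
    (SimpleGraph.fromRel (fun u v => (∃ x y : ℤ × ℤ, u = Sum.inl x ∧ v = Sum.inl y ∧ (x.1 - y.1) ^ 2 + (x.2 - y.2) ^ 2 = 1) ∨ (∃ x f : ℤ × ℤ, u = Sum.inl x ∧ v = Sum.inr f ∧ (x.1 = f.1 ∨ x.1 = f.1 + 1) ∧ (x.2 = f.2 ∨ x.2 = f.2 + 1))) : SimpleGraph MixedSite).Adj (mixedTranslate t a) (mixedTranslate t b) ↔
    (SimpleGraph.fromRel (fun u v => (∃ x y : ℤ × ℤ, u = Sum.inl x ∧ v = Sum.inl y ∧ (x.1 - y.1) ^ 2 + (x.2 - y.2) ^ 2 = 1) ∨ (∃ x f : ℤ × ℤ, u = Sum.inl x ∧ v = Sum.inr f ∧ (x.1 = f.1 ∨ x.1 = f.1 + 1) ∧ (x.2 = f.2 ∨ x.2 = f.2 + 1))) : SimpleGraph MixedSite).Adj a b := by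
  rw [SimpleGraph.fromRel_adj, SimpleGraph.fromRel_adj, (mixedTranslate t).injective.ne_iff]
  exact and_congr_right fun _ => or_congr (shift_gsRel_mixedTranslate t a b) (shift_gsRel_mixedTranslate t b a)

/-! ### stmt-7053 ⟺ translation continuity; the reduction -/

/-- **stmt-7053 ⟺ one-mesh translation continuity of the type-II pivotal mass.** For any odd
lattice vector `t` (`w_t = ((t.1 + t.2) + (t.2 - t.1) i)/√2`): `DomainShiftBalance` holds iff for
every conformal rectangle `R` the type-II pivotal mass `Σ_{f even} P_q(inr f pivotal)` of the
crude crossing of `(Ω_R; arc₀, arc₂)` at mesh `δ` differs by `o(1)` as `δ → 0⁺`, uniformly in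
`q ∈ [0, 1]`, from the type-II pivotal mass of the translated data
`(Ω_R - δw_t; arc₀ - δw_t, arc₂ - δw_t)` (preimages under `x ↦ x + δ w_t`) at the same mesh and the
same `q` (the `let`s `Gs, z, P, cross, piv` are verbatim those of stmt-7053; `crossτ, pivτ` are the
same events for the translated data).  Pure rewriting by `shift_massIII_eq_massII_translate` read at
`1 - q`. [cite: Beffara2008Universal, §5.2 eq. (almost)] -/
theorem shift_domainShiftBalance_iff_translationContinuity {t : ℤ × ℤ} (ht : Odd (t.1 + t.2)) :
    CardySectorGap.DomainShiftBalance ↔ ∀ R : Literature.Probability.RandomPlanarGeometry.ConformalRectangle, let Gs : SimpleGraph Literature.Barriers.CriticalPhenomena.MixedSite := SimpleGraph.fromRel (fun u v => (∃ x y : ℤ × ℤ, u = Sum.inl x ∧ v = Sum.inl y ∧ (x.1 - y.1) ^ 2 + (x.2 - y.2) ^ 2 = 1) ∨ (∃ x f : ℤ × ℤ, u = Sum.inl x ∧ v = Sum.inr f ∧ (x.1 = f.1 ∨ x.1 = f.1 + 1) ∧ (x.2 = f.2 ∨ x.2 = f.2 + 1))); let z : Literature.Barriers.CriticalPhenomena.MixedSite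 → ℂ := fun u => Sum.elim (fun x : ℤ × ℤ => (((x.1 + x.2 : ℤ) : ℂ) + ((x.2 - x.1 + 1 : ℤ) : ℂ) * Complex.I) / (Real.sqrt 2 : ℂ)) (fun f : ℤ × ℤ => (((f.1 + f.2 + 1 : ℤ) : ℂ) + ((f.2 - f.1 + 1 : ℤ) : ℂ) * Complex.I) / (Real.sqrt 2 : ℂ)) u; let P : unitInterval → MeasureTheory.Measure (Set Literature.Barriers.CriticalPhenomena.MixedSite) := fun q => Literature.Probability.LatticeModels.prodBernoulli (Literature.Barriers.CriticalPhenomena.mixedParam q); let cross : ℝ → Set (Set Literature.Barriers.CriticalPhenomena.MixedSite) := fun δ => {ω | ∃ u v, Metric.infDist ((δ : ℂ) * z u) (R.arc 0) ≤ 2 * δ ∧ Metric.infDist ((δ : ℂ) * z v) (R.arc 2) ≤ 2 * δ ∧ ω ∈ Literature.Probability.Percolation.siteConnIn Gs {y | (δ : ℂ) * z y ∈ R.carrier} u v}; let piv : ℝ → Literature.Barriers.CriticalPhenomena.MixedSite → Set (Set Literature.Barriers.CriticalPhenomena.MixedSite) := fun δ v => {ω | insert v ω ∈ cross δ ∧ ω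 \ {v} ∉ cross δ}; let w : ℂ := (((t.1 + t.2 : ℤ) : ℂ) + ((t.2 - t.1 : ℤ) : ℂ) * Complex.I) / (Real.sqrt 2 : ℂ); let crossτ : ℝ → Set (Set Literature.Barriers.CriticalPhenomena.MixedSite) := fun δ => {ω | ∃ u v, Metric.infDist ((δ : ℂ) * z u) ((fun x : ℂ => x + (δ : ℂ) * w) ⁻¹' R.arc 0) ≤ 2 * δ ∧ Metric.infDist ((δ : ℂ) * z v) ((fun x : ℂ => x + (δ : ℂ) * w) ⁻¹' R.arc 2) ≤ 2 * δ ∧ ω ∈ Literature.Probability.Percolation.siteConnIn Gs {y | (δ : ℂ) * z y ∈ (fun x : ℂ => x + (δ : ℂ) * w) ⁻¹' R.carrier} u v}; let pivτ : ℝ → Literature.Barriers.CriticalPhenomena.MixedSite → Set (Set Literature.Barriers.CriticalPhenomena.MixedSite) := fun δ v => {ω | insert v ω ∈ crossτ δ ∧ ω \ {v} ∉ crossτ δ}; ∀ ε : ℝ, 0 < ε → ∃ δ₀ : ℝ, 0 < δ₀ ∧ ∀ δ : ℝ, 0 < δ → δ < δ₀ → ∀ q : unitInterval, |(∑' f : ℤ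 × ℤ, if Even (f.1 + f.2) then (P q).real (piv δ (Sum.inr f)) else 0) - (∑' f : ℤ × ℤ, if Even (f.1 + f.2) then (P q).real (pivτ δ (Sum.inr f)) else 0)| < ε := by
  constructor
  · intro hS R Gs z P cross piv w crossτ pivτ ε hε
    obtain ⟨δ₀, hδ₀, h⟩ := hS R ε hε
    refine ⟨δ₀, hδ₀, fun δ hδ hlt q => ?_⟩
    have e : (∑' f : ℤ × ℤ, if Even (f.1 + f.2) then 0 else (P (unitInterval.symm q)).real
          (piv δ (Sum.inr f))) =
        ∑' f : ℤ × ℤ, if Even (f.1 + f.2) then (P (unitInterval.symm (unitInterval.symm q))).real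
          (pivτ δ (Sum.inr f)) else 0 :=
      shift_massIII_eq_massII_translate ht (shift_gs_adj_mixedTranslate t) (shift_z_mixedTranslate t)
        (unitInterval.symm q) R.carrier (R.arc 0) (R.arc 2) δ
    have key := h δ hδ hlt (unitInterval.symm q)
    rw [e, unitInterval.symm_symm, abs_sub_comm] at key
    exact key
  · intro hH R Gs z P cross piv ε hε
    obtain ⟨δ₀, hδ₀, h⟩ := hH R ε hε
    refine ⟨δ₀, hδ₀, fun δ hδ hlt q => ?_⟩
    have e : (∑' f : ℤ × ℤ, if Even (f.1 + f.2) then 0 else (P q).real (piv δ (Sum.inr f))) = _ :=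
      shift_massIII_eq_massII_translate ht (shift_gs_adj_mixedTranslate t) (shift_z_mixedTranslate t)
        q R.carrier (R.arc 0) (R.arc 2) δ
    rw [e, abs_sub_comm]
    exact h δ hδ hlt (unitInterval.symm q)

/-- **The reduction (stub `stub_domainShiftBalance`, structural part).** One-mesh translation
continuity of the type-II pivotal mass, uniformly in `q` (Beffara's eq. (almost): the boundary
three-arm counting estimate for the mixed family — the ONE analytic input not in the tree), for a
single odd lattice vector `t`, implies route CardySectorGap's `DomainShiftBalance` (stmt-7053).
[cite: Beffara2008Universal, §5.2 eq. (almost)] -/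
theorem shift_domainShiftBalance_of_translationContinuity : ∀ {t : ℤ × ℤ}, Odd (t.1 + t.2) → (∀ R : Literature.Probability.RandomPlanarGeometry.ConformalRectangle, let Gs : SimpleGraph Literature.Barriers.CriticalPhenomena.MixedSite := SimpleGraph.fromRel (fun u v => (∃ x y : ℤ × ℤ, u = Sum.inl x ∧ v = Sum.inl y ∧ (x.1 - y.1) ^ 2 + (x.2 - y.2) ^ 2 = 1) ∨ (∃ x f : ℤ × ℤ, u = Sum.inl x ∧ v = Sum.inr f ∧ (x.1 = f.1 ∨ x.1 = f.1 + 1) ∧ (x.2 = f.2 ∨ x.2 = f.2 + 1))); let z : Literature.Barriers.CriticalPhenomena.MixedSite → ℂ := fun u => Sum.elim (fun x : ℤ × ℤ => (((x.1 + x.2 : ℤ) : ℂ) + ((x.2 - x.1 + 1 : ℤ) : ℂ) * Complex.I) / (Real.sqrt 2 : ℂ)) (fun f : ℤ × ℤ => (((f.1 + f.2 + 1 : ℤ) : ℂ) + ((f.2 - f.1 + 1 : ℤ) : ℂ) * Complex.I) / (Real.sqrt 2 : ℂ)) u; let P : unitInterval → MeasureTheory.Measure (Set Literature.Barriers.CriticalPhenomena.MixedSite)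 := fun q => Literature.Probability.LatticeModels.prodBernoulli (Literature.Barriers.CriticalPhenomena.mixedParam q); let cross : ℝ → Set (Set Literature.Barriers.CriticalPhenomena.MixedSite) := fun δ => {ω | ∃ u v, Metric.infDist ((δ : ℂ) * z u) (R.arc 0) ≤ 2 * δ ∧ Metric.infDist ((δ : ℂ) * z v) (R.arc 2) ≤ 2 * δ ∧ ω ∈ Literature.Probability.Percolation.siteConnIn Gs {y | (δ : ℂ) * z y ∈ R.carrier} u v}; let piv : ℝ → Literature.Barriers.CriticalPhenomena.MixedSite → Set (Set Literature.Barriers.CriticalPhenomena.MixedSite) := fun δ v => {ω | insert v ω ∈ cross δ ∧ ω \ {v} ∉ cross δ}; let w : ℂ := (((t.1 + t.2 : ℤ) : ℂ) + ((t.2 - t.1 : ℤ) : ℂ) * Complex.I) / (Real.sqrt 2 : ℂ); let crossτ : ℝ → Set (Set Literature.Barriers.CriticalPhenomena.MixedSite) := fun δ => {ω | ∃ u v, Metric.infDist ((δ : ℂ) * z u) ((fun x : ℂ => x + (δ : ℂ) * w) ⁻¹' R.arc 0) ≤ 2 * δ ∧ Metric.infDist ((δ : ℂ) * z v) ((fun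 x : ℂ => x + (δ : ℂ) * w) ⁻¹' R.arc 2) ≤ 2 * δ ∧ ω ∈ Literature.Probability.Percolation.siteConnIn Gs {y | (δ : ℂ) * z y ∈ (fun x : ℂ => x + (δ : ℂ) * w) ⁻¹' R.carrier} u v}; let pivτ : ℝ → Literature.Barriers.CriticalPhenomena.MixedSite → Set (Set Literature.Barriers.CriticalPhenomena.MixedSite) := fun δ v => {ω | insert v ω ∈ crossτ δ ∧ ω \ {v} ∉ crossτ δ}; ∀ ε : ℝ, 0 < ε → ∃ δ₀ : ℝ, 0 < δ₀ ∧ ∀ δ : ℝ, 0 < δ → δ < δ₀ → ∀ q : unitInterval, |(∑' f : ℤ × ℤ, if Even (f.1 + f.2) then (P q).real (piv δ (Sum.inr f)) else 0) - (∑' f : ℤ × ℤ, if Even (f.1 + f.2) then (P q).real (pivτ δ (Sum.inr f)) else 0)| < ε) → Summit.CriticalPhenomena.CardyFormulaZ2.Theses.CardySectorGap.DomainShiftBalance :=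
  fun ht H => (shift_domainShiftBalance_iff_translationContinuity ht).2 H

end Summit.CriticalPhenomena.CardyFormulaZ2.Cruxes.CoveringLeg.FiveArmNull

end
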